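/-
Copyright (c) 2026. All rights reserved.
Released under Apache 2.0 license as described in the file LICENSE.
Authors: abc-iut cell, seat abc-iut-w5-d218 (gen 3).
-/
import Literature.GroupTheory.ProPPowerMap
import Literature.GroupTheory.CommutatorWidthLowerCentral

/-!
# The derived subgroup of a topologically finitely generated pro-`p` group is closed

J. D. Dixon, M. du Sautoy, A. Mann, D. Segal, *Analytic pro-`p` groups* (2nd ed.), Prop. 1.19:
if `M` is a pro-`p` group topologically generated by `a₁, …, a_d` then
`[M, M] = {⁅x₁, a₁⁆ ⋯ ⁅x_d, a_d⁆ | xᵢ ∈ M}`; in particular the ABSTRACT derived subgroup `[M, M]` is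
closed (indeed compact).  Proof: the right-hand side `T(l)` is compact (a continuous image of `M^d`);
in every finite quotient `M ⧸ U` (a finite `p`-group, hence nilpotent, generated by the images of the
`aᵢ`) the derived group IS the image of `T(l)` by the width lemma
(`CommutatorWidthLowerCentral.lean`); so the closure of `[M, M]` lies in `⋂_U T(l)·U = T(l) ⊆ [M, M]`.

Vocabulary as in `ProPPowerMap.lean` (Mathlib only; "pro-`p`" and "topologically finitely generated"
are spelled out as hypotheses; no definition is introduced):
* `closure_map_mk_eq_top_of_dense` — a dense subgroup maps ONTO every quotient by an open normal
  subgroup;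
* `image_listProd_commSet_top` — a surjective homomorphism maps `T(l)` onto `T(f(l))`;
* `isCompact_listProd_commSet_top` — `T(l)` is compact;
* `closure_commutator_subset_listProd_of_proP`, `commutator_eq_listProd_of_proP`,
  `isClosed_commutator_of_proP` — DdSMS Prop. 1.19.

[cite: DDMSAnalyticProP1999, Prop 1.19]
-/

namespace Literature.GroupTheory

open scoped Pointwise commutatorElement

section General

variable {M : Type*} [Group M] [TopologicalSpace M]

/-- A dense subgroup `D` of a topological group maps onto `M ⧸ U` for every open normal subgroup `U`
(every coset `gU` is open, so it meets `D`). [cite: DDMSAnalyticProP1999, §1.2] -/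
theorem map_mk_eq_top_of_dense [ContinuousMul M] [ContinuousInv M] {D : Subgroup M}
    (hD : Dense (D : Set M)) (U : OpenNormalSubgroup M) :
    D.map (QuotientGroup.mk' (U : Subgroup M)) = ⊤ := by
  refine eq_top_iff.mpr fun q _ => ?_
  induction q using QuotientGroup.induction_on with
  | H g =>
    have hopen : IsOpen {x : M | x⁻¹ * g ∈ (U : Set M)} :=
      U.isOpen.preimage (continuous_inv.mul continuous_const)
    obtain ⟨d, hd, hdg⟩ := hD.exists_mem_open hopen ⟨g, by simp⟩
    exact ⟨d, hd, (QuotientGroup.eq.mpr hdg)⟩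

/-- List form: if the subgroup generated by the entries of `l` is dense, their images generate
`M ⧸ U` for every open normal subgroup `U`. [cite: DDMSAnalyticProP1999, §1.2] -/
theorem closure_map_mk_eq_top_of_dense [ContinuousMul M] [ContinuousInv M] {l : List M}
    (hl : Dense ((Subgroup.closure {a : M | a ∈ l} : Subgroup M) : Set M))
    (U : OpenNormalSubgroup M) :
    Subgroup.closure {q : M ⧸ (U : Subgroup M) | q ∈ l.map (QuotientGroup.mk' (U : Subgroup M))} =
      ⊤ := by
  have hset : {q : M ⧸ (U : Subgroup M) | q ∈ l.map (QuotientGroup.mk' (U : Subgroup M))} =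
      (QuotientGroup.mk' (U : Subgroup M)) '' {a : M | a ∈ l} := by
    ext q
    simp only [List.mem_map, Set.mem_setOf_eq, Set.mem_image]
  rw [hset, ← MonoidHom.map_closure]
  exact map_mk_eq_top_of_dense hl U

omit [TopologicalSpace M] in
/-- A surjective homomorphism `f` maps `T(l) = {⁅x₁,a₁⁆⋯⁅x_d,a_d⁆}` onto `T(f(l))`.
[cite: DDMSAnalyticProP1999, Prop 1.19 (proof)] -/
theorem image_listProd_commSet_top {Q : Type*} [Group Q] (f : M →* Q)
    (hf : Function.Surjective f) (l : List M) :
    f '' (l.map fun a => (fun y : M => ⁅y, a⁆) '' ((⊤ : Subgroup M) : Set M)).prod =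
      ((l.map f).map fun b => (fun z : Q => ⁅z, b⁆) '' ((⊤ : Subgroup Q) : Set Q)).prod := by
  induction l with
  | nil => simp [Set.singleton_one]
  | cons a l ih =>
    rw [List.map_cons, List.prod_cons, List.map_cons, List.map_cons, List.prod_cons, Set.image_mul,
      ih]
    congr 1
    ext z
    simp only [Subgroup.coe_top, Set.image_univ, Set.mem_image, Set.mem_range]
    constructor
    · rintro ⟨_, ⟨y, rfl⟩, rfl⟩
      exact ⟨f y, (map_commutatorElement f y a).symm⟩
    · rintro ⟨z, rfl⟩
      obtain ⟨y, rfl⟩ := hf z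
      exact ⟨⁅y, a⁆, ⟨y, rfl⟩, map_commutatorElement f y a⟩

/-- `T(l) = {⁅x₁,a₁⁆⋯⁅x_d,a_d⁆ | xᵢ ∈ M}` is compact in a compact topological group (a product of
`d` continuous images of `M`). [cite: DDMSAnalyticProP1999, Prop 1.19 (proof)] -/
theorem isCompact_listProd_commSet_top [IsTopologicalGroup M] [CompactSpace M] (l : List M) :
    IsCompact (l.map fun a => (fun y : M => ⁅y, a⁆) '' ((⊤ : Subgroup M) : Set M)).prod := by
  induction l with
  | nil => rw [List.map_nil, List.prod_nil, ← Set.singleton_one]; exact isCompact_singleton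
  | cons a l ih =>
    rw [List.map_cons, List.prod_cons]
    refine IsCompact.mul ?_ ih
    rw [Subgroup.coe_top, Set.image_univ]
    have hc : Continuous fun y : M => ⁅y, a⁆ := by
      simp only [commutatorElement_def]; fun_prop
    exact isCompact_range hc

end General

section ProP

variable {M : Type*} [Group M] [TopologicalSpace M] [IsTopologicalGroup M] [CompactSpace M]
  [TotallyDisconnectedSpace M] {p : ℕ} [Fact p.Prime]

/-- **DdSMS Prop. 1.19, inclusion.** In a pro-`p` group topologically generated by the entries
`a₁, …, a_d` of `l`, the CLOSURE of the derived subgroup is contained in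
`T(l) = {⁅x₁,a₁⁆⋯⁅x_d,a_d⁆}`: for each open normal `U`, `M ⧸ U` is a finite `p`-group generated by
the images of the `aᵢ`, so its derived group is the image of `T(l)` (nilpotent width lemma), whence
`closure [M,M] ⊆ T(l)·U`; and `⋂_U T(l)·U = T(l)` as `T(l)` is compact.
[cite: DDMSAnalyticProP1999, Prop 1.19] -/
theorem closure_commutator_subset_listProd_of_proP
    (hP : ∀ U : OpenNormalSubgroup M, IsPGroup p (M ⧸ (U : Subgroup M))) {l : List M}
    (hl : Dense ((Subgroup.closure {a : M | a ∈ l} : Subgroup M) : Set M)) :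
    closure (commutator M : Set M) ⊆
      (l.map fun a => (fun y : M => ⁅y, a⁆) '' ((⊤ : Subgroup M) : Set M)).prod := by
  intro g hg
  refine mem_of_forall_mem_mul_openNormalSubgroup (isCompact_listProd_commSet_top l).isClosed
    fun U => ?_
  -- `g ∈ [M,M] ⊔ U`, an open (hence closed) subgroup containing `[M,M]`
  have hsup : g ∈ commutator M ⊔ (U : Subgroup M) := by
    have hopen : IsOpen ((commutator M ⊔ (U : Subgroup M) : Subgroup M) : Set M) :=
      Subgroup.isOpen_mono le_sup_right U.isOpen
    have hcl : IsClosed ((commutator M ⊔ (U : Subgroup M) : Subgroup M) : Set M) :=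
      Subgroup.isClosed_of_isOpen _ hopen
    exact (hcl.closure_subset_iff.mpr (SetLike.coe_subset_coe.mpr le_sup_left)) hg
  obtain ⟨c, hc, u, hu, rfl⟩ := Subgroup.mem_sup_of_normal_right.mp hsup
  -- the finite `p`-group `M ⧸ U`
  haveI : Finite (M ⧸ (U : Subgroup M)) :=
    Subgroup.quotient_finite_of_isOpen (U : Subgroup M) U.isOpen
  haveI : Group.IsNilpotent (M ⧸ (U : Subgroup M)) := (hP U).isNilpotent
  have hgen := closure_map_mk_eq_top_of_dense hl U
  have hwidth := commutator_eq_listProd_of_isNilpotent hgen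
  -- the image of `c` is a commutator-product in `M ⧸ U`, i.e. the image of an element of `T(l)`
  have hcQ : (QuotientGroup.mk' (U : Subgroup M)) c ∈ commutator (M ⧸ (U : Subgroup M)) := by
    have h1 : (commutator M).map (QuotientGroup.mk' (U : Subgroup M)) ≤
        commutator (M ⧸ (U : Subgroup M)) := by
      rw [commutator, commutator, Subgroup.map_commutator]
      exact Subgroup.commutator_mono le_top le_top
    exact h1 (Subgroup.mem_map_of_mem _ hc)
  have hcT : (QuotientGroup.mk' (U : Subgroup M)) c ∈ (QuotientGroup.mk' (U : Subgroup M)) ''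
      (l.map fun a => (fun y : M => ⁅y, a⁆) '' ((⊤ : Subgroup M) : Set M)).prod := by
    rw [image_listProd_commSet_top _ (QuotientGroup.mk'_surjective _), ← hwidth]
    exact hcQ
  obtain ⟨w, hw, hwc⟩ := hcT
  have hwc' : w⁻¹ * c ∈ (U : Subgroup M) := QuotientGroup.eq.mp hwc
  exact Set.mem_mul.mpr ⟨w, hw, w⁻¹ * c * u, mul_mem hwc' hu, by group⟩

/-- **DdSMS Prop. 1.19.** In a pro-`p` group topologically generated by `a₁, …, a_d`,
`[M, M] = {⁅x₁,a₁⁆⋯⁅x_d,a_d⁆ | xᵢ ∈ M}` — every element of the (abstract) derived subgroup is a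
product of `d` commutators with the generators. [cite: DDMSAnalyticProP1999, Prop 1.19] -/
theorem commutator_eq_listProd_of_proP
    (hP : ∀ U : OpenNormalSubgroup M, IsPGroup p (M ⧸ (U : Subgroup M))) {l : List M}
    (hl : Dense ((Subgroup.closure {a : M | a ∈ l} : Subgroup M) : Set M)) :
    (commutator M : Set M) =
      (l.map fun a => (fun y : M => ⁅y, a⁆) '' ((⊤ : Subgroup M) : Set M)).prod :=
  Set.Subset.antisymm (subset_closure.trans (closure_commutator_subset_listProd_of_proP hP hl))
    (listProd_commSet_top_subset_commutator l)

/-- **The derived subgroup of a topologically finitely generated pro-`p` group is compact.**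
[cite: DDMSAnalyticProP1999, Prop 1.19] -/
theorem isCompact_commutator_of_proP
    (hP : ∀ U : OpenNormalSubgroup M, IsPGroup p (M ⧸ (U : Subgroup M)))
    (hfg : ∃ S : Finset M, Dense ((Subgroup.closure (S : Set M) : Subgroup M) : Set M)) :
    IsCompact (commutator M : Set M) := by
  obtain ⟨S, hS⟩ := hfg
  have hl : Dense ((Subgroup.closure {a : M | a ∈ S.toList} : Subgroup M) : Set M) := by
    have : {a : M | a ∈ S.toList} = (S : Set M) := by ext a; simp
    rwa [this]
  rw [commutator_eq_listProd_of_proP hP hl]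
  exact isCompact_listProd_commSet_top _

/-- **The derived subgroup of a topologically finitely generated pro-`p` group is closed**
(DdSMS Prop. 1.19; the key to Serre's theorem, DdSMS Thm 1.17).
[cite: DDMSAnalyticProP1999, Prop 1.19] -/
theorem isClosed_commutator_of_proP
    (hP : ∀ U : OpenNormalSubgroup M, IsPGroup p (M ⧸ (U : Subgroup M)))
    (hfg : ∃ S : Finset M, Dense ((Subgroup.closure (S : Set M) : Subgroup M) : Set M)) :
    IsClosed (commutator M : Set M) :=
  (isCompact_commutator_of_proP hP hfg).isClosed

end ProP

end Literature.GroupTheory
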